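import Mathlib
import Summits.ValiantsHypothesis.ValiantsHypothesis.Theorems.NewtonUnitEquationsDissociatedUniformTotalsLaw
import Summits.ValiantsHypothesis.ValiantsHypothesis.Theorems.NewtonUnitEquationsDissociatedUniformTotalsLawChartTops
import Summits.ValiantsHypothesis.ValiantsHypothesis.Theorems.NewtonUnitEquationsDissociatedUniformTotalsLawSweep
import Literature.Computability.AlgebraicComplexity.NewtonPolygonTauProductBounds
import HarnessLib

/-!
# Crux `NewtonUnitEquations.DissociatedUniform` (stmt-ValiantsHypothesis-5905): the `n = 3` totals law — SHALLOW VERTICES ARE `O(q²)`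
# for arbitrary curves (the law reduces to its DEEP vertices)

Setting of `…DissociatedUniformTotalsLaw`: `a b c : G → ℝ²`, class `s` = `{a x + b y + c z : x + y + z = s}`, `V_s`, `T = ∑_s V_s`.
Call a hull vertex `v` of class `s` **`c`-shallow** if for some chart weight `w = (σ, t)` (`σ = ±1`) at which `v` is the strict top
of its class, `v` has a spelling `a x + b y + c z` (`x + y + z = s`) whose third letter `c z` is at the same time the strict top of the
whole alphabet `C = c(G)`; `a`-shallow and `b`-shallow likewise; **deep** otherwise (all three letters beaten in their own alphabets
at every exposing weight).  Both extreme regimes of the law consist of shallow vertices only (third curve dominant: every class top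
sits at the top letter of `C`; third curve negligible: every class top is `top(A) + top(B) + ·`), and so do random configurations.

PROVED HERE (no hypothesis on `a, b`; `c` injective for the bookkeeping), by the kinetic counting of `…TotalsLawChartTops`
(`sum_card_chartTops_le`: an ORDERED family of time sets shares few tops) exactly as in the abstract sweep `…TotalsLawSweep`
but with the cores ALONE (no windows, hence no `|G|²` term):
* `card_shallowTops_class_le` — along one half-chart, the `c`-shallow tops of class `s` are charged injectively to pairs
  (position `z`, strict top of the fibre `P_{s-z}` at a time at which `c z` tops `C`);
* `sum_card_shallowTops_le` — summed over the classes and re-indexed, `∑_s #shallow_σ(s) ≤ ∑_r #tops_σ(P_r) + |G|·#tops_σ(C)`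
  (the `C`-top time sets are pairwise ordered, so each fibre meets at most `#tops_σ(P_r) + #tops_σ(C)` charges);
* **`sum_card_shallow_le`** — both half-charts: `∑_s #{c-shallow vertices of class s} ≤ V_P + |G|·V(C) + 4|G| ≤ 2|G|² + 4|G|`
  (`V_P = ∑_r V(P_r)`, `V(C) = #vert conv C`);
* **`totalVert_le_of_all_shallow`** — if every hull vertex of every class is `c`-shallow then `T ≤ V_P + |G|·V(C) + 4|G| ≤ 2|G|² + 4|G|`:
  the sharp constant `2` of `SharpTotalsLawThree` on the whole "no deep vertex" stratum, which contains both regimes.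
By the symmetry `T(a,b,c) = T(b,c,a) = T(c,a,b)` the same bounds hold for `a`- and `b`-shallow vertices, so
`T ≤ (V_P + V_Q + V_R) + |G|(V(A) + V(B) + V(C)) + 12|G| + #deep ≤ 6|G|² + 12|G| + #deep`: **the `n = 3` totals law is equivalent to
`#deep = O(|G|²)`** (memo `Cruxes/DissociatedUniform/NOTES-t1g11.md` §4; census there: `#deep ≤ 0.2·q²` in all probes, one class can
hold `≈ q²/4` deep vertices — the parabola gadget of NOTES-d1g3 L2 — so the deep law is a genuine TOTALS statement).
Honest label: an unconditional structure theorem; `TotalsLawThree`, `SharpTotalsLawThree` remain OPEN (now: for deep vertices);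
nothing here bears on VP ≠ VNP.
[folklore]
-/

set_option linter.dupNamespace false -- `ValiantsHypothesis.ValiantsHypothesis` (summit = problem) in every name

open scoped BigOperators
open Matrix Finset

namespace Summit.ValiantsHypothesis.ValiantsHypothesis.Theorems.NewtonUnitEquationsDissociatedUniform

namespace TotalsLaw

open Literature.Computability.AlgebraicComplexity.KPTT.PlanarMinkowski

variable {G : Type*} [AddCommGroup G] [Fintype G]

/-! ### One class, one half-chart: charging shallow tops to (position, fibre top at a `C`-top time) -/

open Classical in
/-- **Charging the `c`-shallow tops.**  Along the half-chart `σ`, every strict top `v = a x + b y + c (s-x-y)` of class `s` taken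
at a time `t` at which `c (s-x-y)` is the strict top of `C` is `c z +` a strict top of the fibre `P_{s-z}` at a `C`-top time of
`z = s - x - y`; hence their number is at most `∑_z #{tops of P_{s-z} at C-top times of z}`. [folklore] -/
theorem card_shallowTops_class_le (a b c : G → (Fin 2 → ℝ)) (σ : ℝ) (s : G) :
    ((Finset.univ.image fun p : G × G => a p.1 + b p.2 + c (s - p.1 - p.2)).filter fun v =>
        ∃ t : ℝ, ∃ p : G × G, a p.1 + b p.2 + c (s - p.1 - p.2) = v ∧
          IsStrictTop ![σ, t] (Finset.univ.image fun p : G × G => a p.1 + b p.2 + c (s - p.1 - p.2)) v ∧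
          IsStrictTop ![σ, t] (Finset.univ.image c) (c (s - p.1 - p.2))).card ≤
      ∑ z, ((Finset.univ.image fun x : G => a x + b (s - z - x)).filter fun q =>
          ∃ t : ℝ, IsStrictTop ![σ, t] (Finset.univ.image c) (c z) ∧
            IsStrictTop ![σ, t] (Finset.univ.image fun x : G => a x + b (s - z - x)) q).card := by
  classical
  set F := Finset.univ.image fun p : G × G => a p.1 + b p.2 + c (s - p.1 - p.2) with hF
  set P : G → Finset (Fin 2 → ℝ) := fun r => Finset.univ.image fun x : G => a x + b (r - x) with hP
  set A : G → Finset (Fin 2 → ℝ) := fun z =>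
    ((P (s - z)).filter fun q => ∃ t : ℝ, IsStrictTop ![σ, t] (Finset.univ.image c) (c z) ∧
      IsStrictTop ![σ, t] (P (s - z)) q).image fun q => q + c z with hA
  have hsub : (F.filter fun v => ∃ t : ℝ, ∃ p : G × G, a p.1 + b p.2 + c (s - p.1 - p.2) = v ∧
      IsStrictTop ![σ, t] F v ∧ IsStrictTop ![σ, t] (Finset.univ.image c) (c (s - p.1 - p.2))) ⊆
      Finset.univ.biUnion A := by
    intro v hv
    obtain ⟨-, t, ⟨x, y⟩, hxy, htop, hC⟩ := Finset.mem_filter.1 hv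
    set r := x + y with hr
    set z := s - x - y with hz
    have hs : r + z = s := by rw [hr, hz]; abel
    have hy : y = r - x := by rw [hr]; abel
    have hv' : v = a x + b (r - x) + c z := by rw [← hxy, ← hy]
    have hsz : s - z = r := by rw [← hs]; abel
    rw [hv'] at htop
    have hfib := isStrictTop_fibre_of_isStrictTop_class a b c _ s r z x hs htop
    rw [Finset.mem_biUnion]
    refine ⟨z, Finset.mem_univ _, ?_⟩
    rw [hA, Finset.mem_image]
    refine ⟨a x + b (r - x), Finset.mem_filter.2 ⟨?_, t, hC, ?_⟩, hv'.symm⟩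
    · rw [hsz]; exact Finset.mem_image.2 ⟨x, Finset.mem_univ _, rfl⟩
    · rw [hsz]; exact hfib
  refine (Finset.card_le_card hsub).trans (Finset.card_biUnion_le.trans (Finset.sum_le_sum fun z _ => ?_))
  rw [hA]
  exact Finset.card_image_le

/-! ### All classes: re-indexing and the ordered-family count -/

open Classical in
/-- **`∑_s #shallow_σ(s) ≤ ∑_r #tops_σ(P_r) + |G| · #tops_σ(C)`** for `c` injective: after re-indexing `s ↦ s - z` each fibre
`P_r` is charged along the family of `C`-top time sets `{t : c z strict top}`, `z` a chart-top index of `C`; these sets are pairwise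
time-ordered (`…TotalsLawSweep.ordered_of_subset_tops`), so `…ChartTops.sum_card_chartTops_le` bounds the charges on `P_r` by
`#tops_σ(P_r) + #tops_σ(C)`. [folklore] -/
theorem sum_card_shallowTops_le (a b c : G → (Fin 2 → ℝ)) (hc : Function.Injective c) (σ : ℝ) :
    ∑ s, ((Finset.univ.image fun p : G × G => a p.1 + b p.2 + c (s - p.1 - p.2)).filter fun v =>
        ∃ t : ℝ, ∃ p : G × G, a p.1 + b p.2 + c (s - p.1 - p.2) = v ∧
          IsStrictTop ![σ, t] (Finset.univ.image fun p : G × G => a p.1 + b p.2 + c (s - p.1 - p.2)) v ∧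
          IsStrictTop ![σ, t] (Finset.univ.image c) (c (s - p.1 - p.2))).card ≤
      ∑ r, ((Finset.univ.image fun x : G => a x + b (r - x)).filter fun p =>
          ∃ t, IsStrictTop ![σ, t] (Finset.univ.image fun x : G => a x + b (r - x)) p).card +
      Fintype.card G * (Finset.univ.filter fun z : G => ∃ t : ℝ, IsStrictTop ![σ, t] (Finset.univ.image c) (c z)).card := by
  classical
  set P : G → Finset (Fin 2 → ℝ) := fun r => Finset.univ.image fun x : G => a x + b (r - x) with hP
  set Y : G → Set ℝ := fun z => {t | IsStrictTop ![σ, t] (Finset.univ.image c) (c z)} with hY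
  set I : Finset G := Finset.univ.filter fun z : G => ∃ t : ℝ, IsStrictTop ![σ, t] (Finset.univ.image c) (c z) with hI
  set f : G → G → ℕ := fun z r => ((P r).filter fun p => ∃ t ∈ Y z, IsStrictTop ![σ, t] (P r) p).card with hf
  -- per class
  have hclass : ∀ s, ((Finset.univ.image fun p : G × G => a p.1 + b p.2 + c (s - p.1 - p.2)).filter fun v =>
      ∃ t : ℝ, ∃ p : G × G, a p.1 + b p.2 + c (s - p.1 - p.2) = v ∧
        IsStrictTop ![σ, t] (Finset.univ.image fun p : G × G => a p.1 + b p.2 + c (s - p.1 - p.2)) v ∧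
        IsStrictTop ![σ, t] (Finset.univ.image c) (c (s - p.1 - p.2))).card ≤ ∑ z, f z (s - z) := by
    intro s
    refine (card_shallowTops_class_le a b c σ s).trans (le_of_eq (Finset.sum_congr rfl fun z _ => ?_))
    rw [hf]
    congr 1
  refine (Finset.sum_le_sum fun s _ => hclass s).trans ?_
  -- re-index `s ↦ s - z`
  have hre : ∑ s, ∑ z, f z (s - z) = ∑ r, ∑ z, f z r := by
    rw [Finset.sum_comm]
    refine (Finset.sum_congr rfl fun z _ => ?_).trans Finset.sum_comm
    exact Equiv.sum_comp (Equiv.subRight z) (f z)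
  rw [hre]
  -- only chart-top indices of `C` charge anything
  have hzero : ∀ r, ∀ z ∉ I, f z r = 0 := by
    intro r z hz
    rw [hf]
    dsimp only
    rw [Finset.card_eq_zero, Finset.filter_eq_empty_iff]
    intro p _ h
    obtain ⟨t, ht, -⟩ := h
    exact hz (Finset.mem_filter.2 ⟨Finset.mem_univ _, t, ht⟩)
  have hsumI : ∀ r, ∑ z, f z r = ∑ z ∈ I, f z r := by
    intro r
    rw [← Finset.sum_subset (Finset.subset_univ I) fun z _ hz => hzero r z hz]
  -- the ordered-family count, fibre by fibre
  have hfib : ∀ r, ∑ z ∈ I, f z r ≤ ((P r).filter fun p => ∃ t, IsStrictTop ![σ, t] (P r) p).card + I.card := by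
    intro r
    exact sum_card_chartTops_le I Y σ (P r) fun z _ z' _ hzz' =>
      ordered_of_subset_tops (fun h => hzz' (hc h)) (fun t ht => ht) (fun t ht => ht)
  calc ∑ r, ∑ z, f z r = ∑ r, ∑ z ∈ I, f z r := Finset.sum_congr rfl fun r _ => hsumI r
    _ ≤ ∑ r, (((P r).filter fun p => ∃ t, IsStrictTop ![σ, t] (P r) p).card + I.card) :=
        Finset.sum_le_sum fun r _ => hfib r
    _ = _ := by rw [Finset.sum_add_distrib, Finset.sum_const, Finset.card_univ, smul_eq_mul]

/-! ### Both half-charts: shallow vertices are `O(|G|²)` -/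

omit [AddCommGroup G] in
open Classical in
/-- Chart-top indices of an injective curve versus hull vertices of its alphabet: `#I₊ + #I₋ ≤ V(C) + 2`. [folklore] -/
theorem card_topIdx_add_le (c : G → (Fin 2 → ℝ)) (hc : Function.Injective c) :
    (Finset.univ.filter fun z : G => ∃ t : ℝ, IsStrictTop ![1, t] (Finset.univ.image c) (c z)).card +
      (Finset.univ.filter fun z : G => ∃ t : ℝ, IsStrictTop ![-1, t] (Finset.univ.image c) (c z)).card ≤
      ((convexHull ℝ (Set.range c)).extremePoints ℝ).ncard + 2 := by
  classical
  set C := (Finset.univ.image c : Finset (Fin 2 → ℝ)) with hCdef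
  have hcoe : (C : Set (Fin 2 → ℝ)) = Set.range c := by rw [hCdef, Finset.coe_image, Finset.coe_univ, Set.image_univ]
  have himg : ∀ σ : ℝ, (Finset.univ.filter fun z : G => ∃ t : ℝ, IsStrictTop ![σ, t] C (c z)).card =
      (C.filter fun x => ∃ t : ℝ, IsStrictTop ![σ, t] C x).card := by
    intro σ
    rw [← Finset.card_image_of_injective (Finset.univ.filter fun z : G => ∃ t : ℝ, IsStrictTop ![σ, t] C (c z)) hc]
    congr 1
    ext x
    simp only [Finset.mem_image, Finset.mem_filter, Finset.mem_univ, true_and, hCdef]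
    constructor
    · rintro ⟨z, hz, rfl⟩
      exact ⟨⟨z, rfl⟩, hz⟩
    · rintro ⟨⟨z, rfl⟩, hz⟩
      exact ⟨z, hz, rfl⟩
  rw [himg 1, himg (-1), ← hcoe]
  exact card_chartTops_add_card_chartTops_le C

open Classical in
/-- **Shallow vertices are `O(|G|²)`.**  For `c` injective,
`∑_s #{c-shallow hull vertices of class s} ≤ V_P + |G|·V(C) + 4|G|`, where a hull vertex `v` of class `s` is `c`-shallow if it is
the strict top of its class for some chart weight `(±1, t)` at which the third letter `c z` of one of its spellings
`v = a x + b y + c z` is the strict top of `C`. [folklore] -/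
theorem sum_card_shallow_le (a b c : G → (Fin 2 → ℝ)) (hc : Function.Injective c) :
    ∑ s, ((Finset.univ.image fun p : G × G => a p.1 + b p.2 + c (s - p.1 - p.2)).filter fun v =>
        ∃ σ t : ℝ, (σ = 1 ∨ σ = -1) ∧ ∃ p : G × G, a p.1 + b p.2 + c (s - p.1 - p.2) = v ∧
          IsStrictTop ![σ, t] (Finset.univ.image fun p : G × G => a p.1 + b p.2 + c (s - p.1 - p.2)) v ∧
          IsStrictTop ![σ, t] (Finset.univ.image c) (c (s - p.1 - p.2))).card ≤
      fibreTotal a b + Fintype.card G * ((convexHull ℝ (Set.range c)).extremePoints ℝ).ncard + 4 * Fintype.card G := by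
  classical
  -- split the two half-charts
  have hsplit : ∀ s, ((Finset.univ.image fun p : G × G => a p.1 + b p.2 + c (s - p.1 - p.2)).filter fun v =>
        ∃ σ t : ℝ, (σ = 1 ∨ σ = -1) ∧ ∃ p : G × G, a p.1 + b p.2 + c (s - p.1 - p.2) = v ∧
          IsStrictTop ![σ, t] (Finset.univ.image fun p : G × G => a p.1 + b p.2 + c (s - p.1 - p.2)) v ∧
          IsStrictTop ![σ, t] (Finset.univ.image c) (c (s - p.1 - p.2))).card ≤
      ((Finset.univ.image fun p : G × G => a p.1 + b p.2 + c (s - p.1 - p.2)).filter fun v =>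
        ∃ t : ℝ, ∃ p : G × G, a p.1 + b p.2 + c (s - p.1 - p.2) = v ∧
          IsStrictTop ![1, t] (Finset.univ.image fun p : G × G => a p.1 + b p.2 + c (s - p.1 - p.2)) v ∧
          IsStrictTop ![1, t] (Finset.univ.image c) (c (s - p.1 - p.2))).card +
      ((Finset.univ.image fun p : G × G => a p.1 + b p.2 + c (s - p.1 - p.2)).filter fun v =>
        ∃ t : ℝ, ∃ p : G × G, a p.1 + b p.2 + c (s - p.1 - p.2) = v ∧
          IsStrictTop ![-1, t] (Finset.univ.image fun p : G × G => a p.1 + b p.2 + c (s - p.1 - p.2)) v ∧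
          IsStrictTop ![-1, t] (Finset.univ.image c) (c (s - p.1 - p.2))).card := by
    intro s
    refine (Finset.card_le_card fun v hv => ?_).trans (Finset.card_union_le _ _)
    obtain ⟨hvF, σ, t, hσ, p, hp, htop, hC⟩ := Finset.mem_filter.1 hv
    rw [Finset.mem_union, Finset.mem_filter, Finset.mem_filter]
    rcases hσ with rfl | rfl
    · exact Or.inl ⟨hvF, t, p, hp, htop, hC⟩
    · exact Or.inr ⟨hvF, t, p, hp, htop, hC⟩
  have h₁ := sum_card_shallowTops_le a b c hc 1
  have h₂ := sum_card_shallowTops_le a b c hc (-1)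
  have hfib : ∀ r : G, ((Finset.univ.image fun x : G => a x + b (r - x)).filter fun p =>
        ∃ t, IsStrictTop ![1, t] (Finset.univ.image fun x : G => a x + b (r - x)) p).card +
      ((Finset.univ.image fun x : G => a x + b (r - x)).filter fun p =>
        ∃ t, IsStrictTop ![-1, t] (Finset.univ.image fun x : G => a x + b (r - x)) p).card ≤ fibreVert a b r + 2 :=
    fun r => card_chartTops_fibre_add_le a b r
  have hC := card_topIdx_add_le c hc
  calc _ ≤ ∑ s, (((Finset.univ.image fun p : G × G => a p.1 + b p.2 + c (s - p.1 - p.2)).filter fun v =>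
          ∃ t : ℝ, ∃ p : G × G, a p.1 + b p.2 + c (s - p.1 - p.2) = v ∧
            IsStrictTop ![1, t] (Finset.univ.image fun p : G × G => a p.1 + b p.2 + c (s - p.1 - p.2)) v ∧
            IsStrictTop ![1, t] (Finset.univ.image c) (c (s - p.1 - p.2))).card +
        ((Finset.univ.image fun p : G × G => a p.1 + b p.2 + c (s - p.1 - p.2)).filter fun v =>
          ∃ t : ℝ, ∃ p : G × G, a p.1 + b p.2 + c (s - p.1 - p.2) = v ∧
            IsStrictTop ![-1, t] (Finset.univ.image fun p : G × G => a p.1 + b p.2 + c (s - p.1 - p.2)) v ∧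
            IsStrictTop ![-1, t] (Finset.univ.image c) (c (s - p.1 - p.2))).card) :=
        Finset.sum_le_sum fun s _ => hsplit s
    _ ≤ (∑ r, ((Finset.univ.image fun x : G => a x + b (r - x)).filter fun p =>
            ∃ t, IsStrictTop ![1, t] (Finset.univ.image fun x : G => a x + b (r - x)) p).card +
          Fintype.card G * (Finset.univ.filter fun z : G => ∃ t : ℝ, IsStrictTop ![1, t] (Finset.univ.image c) (c z)).card) +
        (∑ r, ((Finset.univ.image fun x : G => a x + b (r - x)).filter fun p =>
            ∃ t, IsStrictTop ![-1, t] (Finset.univ.image fun x : G => a x + b (r - x)) p).card +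
          Fintype.card G * (Finset.univ.filter fun z : G => ∃ t : ℝ, IsStrictTop ![-1, t] (Finset.univ.image c) (c z)).card) := by
        rw [Finset.sum_add_distrib]; exact add_le_add h₁ h₂
    _ = (∑ r, (((Finset.univ.image fun x : G => a x + b (r - x)).filter fun p =>
            ∃ t, IsStrictTop ![1, t] (Finset.univ.image fun x : G => a x + b (r - x)) p).card +
          ((Finset.univ.image fun x : G => a x + b (r - x)).filter fun p =>
            ∃ t, IsStrictTop ![-1, t] (Finset.univ.image fun x : G => a x + b (r - x)) p).card)) +
        Fintype.card G * ((Finset.univ.filter fun z : G => ∃ t : ℝ, IsStrictTop ![1, t] (Finset.univ.image c) (c z)).card +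
          (Finset.univ.filter fun z : G => ∃ t : ℝ, IsStrictTop ![-1, t] (Finset.univ.image c) (c z)).card) := by
        rw [Finset.sum_add_distrib]; ring
    _ ≤ (∑ r, (fibreVert a b r + 2)) +
        Fintype.card G * (((convexHull ℝ (Set.range c)).extremePoints ℝ).ncard + 2) :=
        add_le_add (Finset.sum_le_sum fun r _ => hfib r) (Nat.mul_le_mul_left _ hC)
    _ = fibreTotal a b + Fintype.card G * ((convexHull ℝ (Set.range c)).extremePoints ℝ).ncard + 4 * Fintype.card G := by
        unfold fibreTotal
        rw [Finset.sum_add_distrib, Finset.sum_const, Finset.card_univ, smul_eq_mul]; ring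

omit [AddCommGroup G] in
/-- `V(C) ≤ |G|`. [folklore] -/
theorem ncard_extremePoints_range_le (c : G → (Fin 2 → ℝ)) :
    ((convexHull ℝ (Set.range c)).extremePoints ℝ).ncard ≤ Fintype.card G :=
  (Set.ncard_le_ncard extremePoints_convexHull_subset (Set.finite_range c)).trans (ncard_range_le_card c)

open Classical in
/-- Coarse form: **`∑_s #{c-shallow vertices} ≤ 2|G|² + 4|G|`** (`V_P ≤ |G|²`, `V(C) ≤ |G|`). [folklore] -/
theorem sum_card_shallow_le_sq (a b c : G → (Fin 2 → ℝ)) (hc : Function.Injective c) :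
    ∑ s, ((Finset.univ.image fun p : G × G => a p.1 + b p.2 + c (s - p.1 - p.2)).filter fun v =>
        ∃ σ t : ℝ, (σ = 1 ∨ σ = -1) ∧ ∃ p : G × G, a p.1 + b p.2 + c (s - p.1 - p.2) = v ∧
          IsStrictTop ![σ, t] (Finset.univ.image fun p : G × G => a p.1 + b p.2 + c (s - p.1 - p.2)) v ∧
          IsStrictTop ![σ, t] (Finset.univ.image c) (c (s - p.1 - p.2))).card ≤
      2 * Fintype.card G ^ 2 + 4 * Fintype.card G := by
  have h := sum_card_shallow_le a b c hc
  have h1 : fibreTotal a b ≤ Fintype.card G ^ 2 := fibreTotal_le_card_sq a b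
  have h2 : Fintype.card G * ((convexHull ℝ (Set.range c)).extremePoints ℝ).ncard ≤ Fintype.card G ^ 2 := by
    rw [sq]; exact Nat.mul_le_mul_left _ (ncard_extremePoints_range_le c)
  omega

/-! ### The "no deep vertex" stratum: the sharp constant `2` -/

open Classical in
/-- **All vertices shallow ⇒ `T ≤ V_P + |G|·V(C) + 4|G|`.**  If every hull vertex of every class is `c`-shallow (as in both extreme
regimes of the law) then the totals law holds with its sharp leading constant: `T ≤ V_P + |G|V(C) + 4|G| ≤ 2|G|² + 4|G|`. [folklore] -/
theorem totalVert_le_of_all_shallow (a b c : G → (Fin 2 → ℝ)) (hc : Function.Injective c)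
    (hall : ∀ (s : G) (v : Fin 2 → ℝ), v ∈ (convexHull ℝ (classPts a b c s)).extremePoints ℝ →
      ∃ σ t : ℝ, (σ = 1 ∨ σ = -1) ∧ ∃ p : G × G, a p.1 + b p.2 + c (s - p.1 - p.2) = v ∧
        IsStrictTop ![σ, t] (Finset.univ.image fun p : G × G => a p.1 + b p.2 + c (s - p.1 - p.2)) v ∧
        IsStrictTop ![σ, t] (Finset.univ.image c) (c (s - p.1 - p.2))) :
    totalVert a b c ≤
      fibreTotal a b + Fintype.card G * ((convexHull ℝ (Set.range c)).extremePoints ℝ).ncard + 4 * Fintype.card G := by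
  classical
  refine le_trans ?_ (sum_card_shallow_le a b c hc)
  unfold totalVert
  refine Finset.sum_le_sum fun s _ => ?_
  set F := Finset.univ.image fun p : G × G => a p.1 + b p.2 + c (s - p.1 - p.2) with hF
  have hcoe : (F : Set (Fin 2 → ℝ)) = classPts a b c s := by
    rw [hF, Finset.coe_image, Finset.coe_univ, Set.image_univ]; rfl
  have hfin : ((convexHull ℝ (classPts a b c s)).extremePoints ℝ).Finite :=
    (Set.finite_range _).subset extremePoints_convexHull_subset
  unfold classVert
  rw [← Set.ncard_coe_finset]
  refine Set.ncard_le_ncard (fun v hv => ?_) (Finset.finite_toSet _)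
  have hvF : v ∈ F := by
    rw [← Finset.mem_coe, hcoe]; exact extremePoints_convexHull_subset hv
  exact Finset.mem_coe.2 (Finset.mem_filter.2 ⟨hvF, hall s v hv⟩)

open Classical in
/-- Coarse form of the previous theorem: all vertices `c`-shallow ⇒ `T ≤ 2|G|² + 4|G|`. [folklore] -/
theorem totalVert_le_of_all_shallow_sq (a b c : G → (Fin 2 → ℝ)) (hc : Function.Injective c)
    (hall : ∀ (s : G) (v : Fin 2 → ℝ), v ∈ (convexHull ℝ (classPts a b c s)).extremePoints ℝ →
      ∃ σ t : ℝ, (σ = 1 ∨ σ = -1) ∧ ∃ p : G × G, a p.1 + b p.2 + c (s - p.1 - p.2) = v ∧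
        IsStrictTop ![σ, t] (Finset.univ.image fun p : G × G => a p.1 + b p.2 + c (s - p.1 - p.2)) v ∧
        IsStrictTop ![σ, t] (Finset.univ.image c) (c (s - p.1 - p.2))) :
    totalVert a b c ≤ 2 * Fintype.card G ^ 2 + 4 * Fintype.card G := by
  have h := totalVert_le_of_all_shallow a b c hc hall
  have h1 : fibreTotal a b ≤ Fintype.card G ^ 2 := fibreTotal_le_card_sq a b
  have h2 : Fintype.card G * ((convexHull ℝ (Set.range c)).extremePoints ℝ).ncard ≤ Fintype.card G ^ 2 := by
    rw [sq]; exact Nat.mul_le_mul_left _ (ncard_extremePoints_range_le c)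
  omega

end TotalsLaw

end Summit.ValiantsHypothesis.ValiantsHypothesis.Theorems.NewtonUnitEquationsDissociatedUniform
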